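import Literature.NumberTheory.Sieve.Maynard2016Prop92YSqSumBridge
import Literature.NumberTheory.Sieve.Maynard2016Lemma93Constants
import HarnessLib

/-!
# Maynard 2016, Prop. 9.2 (𝒜 = ℤ): the constant `Π'` of Lemma 8.4 for the moduli `W'_j` — (9.19) ⟹ (9.21)

Source: J. Maynard, *Dense clusters of primes in subsets*, Compositio Math. 152 (2016) = arXiv:1405.2593
[Maynard2016DenseClusters], proof of Proposition 9.2, display (9.19) and «simplifying the products in (9.19)
gives (9.21)» p. 23: after Lemma 8.4 in the `k − 1` coordinates `j ≠ m` (moduli `W'_j`, `g = φ_ω`), the Euler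
product
`Π' = ∏_{p∤a_mWB}(1 + (ω(p)−1)/φ_ω(p))(1 − 1/p)^{k−1} ∏_{p∣a_m, p∤WB}(1 + ω(p)/φ_ω(p))(1 − 1/p)^{k−1}`
combines with the constant `c_m² = (φ(a_mWB) W^{k−1}B^{k−1} 𝔖_{WB}/(a_m φ(WB)^k))²` of Lemma 9.3 into
`(1 + O((log x)^{−1/10})) W^{k−1}B^{k−1}𝔖_{WB}(𝓛)/φ(WB)^{k−1} · ∏_{p∣a_m,p∤WB}(p−1)/p`; K. Ford, B. Green,
S. Konyagin, J. Maynard, T. Tao, *Long gaps between primes*, JAMS 31 (2018) [FordGreenKonyaginMaynardTao2018],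
Thm 6 (7.13) pp. 21–22.

PROVED here (no named facts), for `k = n + 1`, with the moduli `idxModM` and the census of
`Maynard2016Prop92YSqSumBridge` (this is the `Π'`-analogue of `FGKMT2018Prop91PiIdentification`):
* `singFactor_mul_piFactor_eq_div` — the local identity `𝔖-factor · Π'-factor = (p − ω(p) + n(p))/(p − 1)`
  at `p ∤ WB`; hence `= 1` (`p ≤ R`, `p ∤ a_m`), `= p/(p−1)` (`p ≤ R`, `p ∣ a_m`), and
  `corrFactorM = 1 + (n(p) + 1 − ω(p))/(p − 1)` beyond `R` (`= 1` off an exceptional modulus);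
* `singPartial_mul_piPartialM_eq` — the partial products stabilise:
  `𝔖_{WB}(p ≤ y)·Π'(p ≤ y) = (φ(WB)/WB)^{k−1} · ∏_{p∣a_m,p∤WB} p/(p−1) · excProdM`;
* `singSeriesExcl_mul_piRecM_eq` (the limit), `cM_eq_prefactor_mul`
  (`c_m = (WB)^{k−1}𝔖_{WB}/φ(WB)^{k−1} · ∏_{p∣a_m,p∤WB}(1 − 1/p)`), and
  **`logR_cM_sq_mul_piRec_eq_mainCoeffM`**: `(log R · c_m)² · Π' (log R)^{k−1} J = mainCoeffM 𝓛 B R J m · excProdM`;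
* `abs_excProdM_sub_one_le` (`|excProdM − 1| ≤ exp(k·#{p ∣ E : p > ⌊R⌋}/⌊R⌋) − 1`) and, in the frame of
  Prop. 6.1, **`prop92_piRecM_eventually`**: `(log R · c_m)² Π'(log R)^{k−1} J = mainCoeffM · c` with
  `|c − 1| ≤ 1/log X`, together with the size facts on `W'` that Lemma 8.4 needs
  (`W'_j ≠ 0`, `p ≤ 2k² ⇒ p ∣ W'_j`, `W'_j ≤ W B E'` with `log E' ≤ 20 k² log X`).

## References
* J. Maynard, *Dense clusters of primes in subsets*, Compositio Math. 152 (2016), Prop. 9.2 (9.19)–(9.21),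
  Lemma 8.4, Lemma 8.1 [Maynard2016DenseClusters].
* K. Ford, B. Green, S. Konyagin, J. Maynard, T. Tao, *Long gaps between primes*, JAMS 31 (2018), Thm 6
  [FordGreenKonyaginMaynardTao2018].
-/

noncomputable section

open Finset Filter Topology MeasureTheory
open scoped ArithmeticFunction.Moebius

namespace Literature.NumberTheory.Sieve.FGKMT2018

variable {n : ℕ}

/-! ### Local factors -/

/-- Euler's product `∏_{p ∣ D}(1 − 1/p)^r = (φ(D)/D)^r` over `ℝ`. [folklore] -/
private theorem prod_primeFactors_one_sub_inv_pow_eq {D : ℕ} (hD : D ≠ 0) (r : ℕ) :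
    ∏ p ∈ D.primeFactors, (1 - 1 / (p : ℝ)) ^ r = ((Nat.totient D : ℝ) / (D : ℕ)) ^ r := by
  rw [Finset.prod_pow, ← totient_div_self_eq_prod hD]

/-- **The local identity at `p ∤ WB`** (`k = n + 1`, `ω(p) < p`, any free-index count `c`):
`(1 − ω/p)(1 − 1/p)^{−k} · (1 + c/(p − ω))(1 − 1/p)^{k−1} = (p − ω + c)/(p − 1)`.
[cite: Maynard2016DenseClusters, proof of Prop. 9.2 (9.19)⟹(9.21) p. 23 («simplifying the products»); Lemma 8.4 (Π_g) p. 16] -/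
theorem singFactor_mul_piFactor_eq_div (L : Fin (n + 1) → ℤ × ℤ) {p : ℕ} (hp : 2 ≤ p)
    (hω : omegaL L p < p) (c : ℝ) :
    singFactor L p * ((1 + c / ((p : ℝ) - omegaL L p)) * (1 - 1 / (p : ℝ)) ^ n) =
      ((p : ℝ) - omegaL L p + c) / ((p : ℝ) - 1) := by
  unfold singFactor
  have hp0 : (0 : ℝ) < p := by exact_mod_cast (by omega : 0 < p)
  have hp1 : (1 : ℝ) < p := by exact_mod_cast (by omega : 1 < p)
  have hpω : (0 : ℝ) < (p : ℝ) - omegaL L p := by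
    have : ((omegaL L p : ℕ) : ℝ) < p := by exact_mod_cast hω
    linarith
  have hY0 : (1 : ℝ) - 1 / p ≠ 0 := by
    have : (0 : ℝ) < 1 - 1 / p := by rw [sub_pos, div_lt_one hp0]; exact hp1
    exact this.ne'
  have hp1' : (p : ℝ) - 1 ≠ 0 := (sub_pos.2 hp1).ne'
  have hpω' : (p : ℝ) - omegaL L p ≠ 0 := hpω.ne'
  have hY : (1 - 1 / (p : ℝ))⁻¹ ^ (n + 1) * (1 - 1 / (p : ℝ)) ^ n = (1 - 1 / (p : ℝ))⁻¹ := by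
    rw [pow_succ, mul_assoc, mul_comm ((1 - 1 / (p : ℝ))⁻¹) ((1 - 1 / (p : ℝ)) ^ n), ← mul_assoc,
      ← mul_pow, inv_mul_cancel₀ hY0, one_pow, one_mul]
  calc _ = ((1 - (omegaL L p : ℝ) / p) * (1 + c / ((p : ℝ) - omegaL L p))) *
        ((1 - 1 / (p : ℝ))⁻¹ ^ (n + 1) * (1 - 1 / (p : ℝ)) ^ n) := by ring
    _ = ((1 - (omegaL L p : ℝ) / p) * (1 + c / ((p : ℝ) - omegaL L p))) * (1 - 1 / (p : ℝ))⁻¹ := by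
        rw [hY]
    _ = _ := by
        have h1 : (1 : ℝ) - 1 / p = ((p : ℝ) - 1) / p := by field_simp
        rw [h1, inv_div]
        field_simp

/-- The local factor of `𝔖_{WB}(𝓛)·Π'` beyond `R`: `corrFactorM 𝓛 m p = (p − ω(p) + n'(p))/(p − 1)` with
`n'(p) = #{j ≠ m : p ∤ a_j b_m − a_m b_j}` (the number of free indices of `W'` at a prime `p > R`, `p ∤ WB`).
[cite: Maynard2016DenseClusters, proof of Prop. 9.2 (9.8), (9.19) pp. 21, 23; Lemma 8.4 (n(p)) p. 16] -/
def corrFactorM (L : Fin (n + 1) → ℤ × ℤ) (m : Fin (n + 1)) (p : ℕ) : ℝ :=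
  ((p : ℝ) - omegaL L p + #(univ.filter fun j : Fin n => ¬ p ∣ (crossDet L m (m.succAbove j)).natAbs)) /
    ((p : ℝ) - 1)

/-- `corrFactorM = 1` at a prime with `ω(p) = k` dividing none of the `a_j b_m − a_m b_j`.
[cite: Maynard2016DenseClusters, Lemma 8.1 p. 15 (ω(p) = k off the exceptional primes); proof of Prop. 9.2 (9.8)] -/
theorem corrFactorM_eq_one {L : Fin (n + 1) → ℤ × ℤ} {m : Fin (n + 1)} {p : ℕ} (hp : 1 < p)
    (hω : omegaL L p = n + 1) (hΔ : ∀ j : Fin n, ¬ p ∣ (crossDet L m (m.succAbove j)).natAbs) :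
    corrFactorM L m p = 1 := by
  classical
  unfold corrFactorM
  have hcard : #(univ.filter fun j : Fin n => ¬ p ∣ (crossDet L m (m.succAbove j)).natAbs) = n := by
    rw [Finset.filter_true_of_mem fun j _ => hΔ j, Finset.card_univ, Fintype.card_fin]
  rw [hcard, hω]
  have hp1 : (p : ℝ) - 1 ≠ 0 := by
    have : (1 : ℝ) < p := by exact_mod_cast hp
    exact (sub_pos.2 this).ne'
  rw [div_eq_one_iff_eq hp1]
  push_cast
  ring

/-- `|corrFactorM − 1| ≤ k/N` for a prime `p > N ≥ 1` (`|n'(p) + 1 − ω(p)| ≤ k`, `p − 1 ≥ N`).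
[cite: Maynard2016DenseClusters, Lemma 8.1 p. 15 («1 + O(k/p)» at exceptional primes); §7 p. 13 (ω(p) ≤ k)] -/
theorem abs_corrFactorM_sub_one_le {L : Fin (n + 1) → ℤ × ℤ} (hadm : FormsAdmissible L) (m : Fin (n + 1))
    {p N : ℕ} (hp : p.Prime) (hN : 1 ≤ N) (hNp : N < p) :
    |corrFactorM L m p - 1| ≤ ((n + 1 : ℕ) : ℝ) / N := by
  classical
  unfold corrFactorM
  set c := #(univ.filter fun j : Fin n => ¬ p ∣ (crossDet L m (m.succAbove j)).natAbs) with hc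
  have hcn : c ≤ n := by
    rw [hc]; exact (Finset.card_filter_le _ _).trans (by rw [Finset.card_univ, Fintype.card_fin])
  have hω : omegaL L p ≤ n + 1 := omegaL_le_card_of_admissible hadm hp
  have hN0 : (0 : ℝ) < N := by exact_mod_cast hN
  have hpN : (N : ℝ) ≤ (p : ℝ) - 1 := by
    have : (N : ℝ) + 1 ≤ p := by exact_mod_cast hNp
    linarith
  have hp1 : (0 : ℝ) < (p : ℝ) - 1 := lt_of_lt_of_le hN0 hpN
  have hnum : |((p : ℝ) - omegaL L p + c) - ((p : ℝ) - 1)| ≤ ((n + 1 : ℕ) : ℝ) := by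
    have h1 : ((c : ℕ) : ℝ) ≤ n := by exact_mod_cast hcn
    have h2 : ((omegaL L p : ℕ) : ℝ) ≤ ((n + 1 : ℕ) : ℝ) := by exact_mod_cast hω
    have h3 : (0 : ℝ) ≤ c := Nat.cast_nonneg _
    have h4 : (0 : ℝ) ≤ omegaL L p := Nat.cast_nonneg _
    rw [abs_le]
    push_cast at h2 ⊢
    constructor <;> linarith
  rw [div_sub_one hp1.ne', abs_div, abs_of_pos hp1]
  calc |((p : ℝ) - omegaL L p + c) - ((p : ℝ) - 1)| / ((p : ℝ) - 1)
      ≤ ((n + 1 : ℕ) : ℝ) / ((p : ℝ) - 1) := div_le_div_of_nonneg_right hnum hp1.le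
    _ ≤ ((n + 1 : ℕ) : ℝ) / N := div_le_div_of_nonneg_left (Nat.cast_nonneg _) hN0 hpN

/-- The exceptional Euler factors of `𝔖_{WB}(𝓛)·Π'` beyond `R`:
`excProdM 𝓛 m D N E = ∏_{p ∣ E, p > N, p ∤ D} corrFactorM 𝓛 m p`.
[cite: Maynard2016DenseClusters, proof of Prop. 9.2 (9.19)⟹(9.21) p. 23; Lemma 8.1 p. 15] -/
def excProdM (L : Fin (n + 1) → ℤ × ℤ) (m : Fin (n + 1)) (D N E : ℕ) : ℝ :=
  ∏ p ∈ E.primeFactors.filter (fun p => N < p ∧ ¬ p ∣ D), corrFactorM L m p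

/-- `|∏ fᵢ − 1| ≤ ∏(1 + |fᵢ − 1|) − 1`. [folklore] -/
private theorem abs_prod_sub_one_le {ι : Type*} (s : Finset ι) (f : ι → ℝ) :
    |∏ i ∈ s, f i - 1| ≤ ∏ i ∈ s, (1 + |f i - 1|) - 1 := by
  classical
  induction s using Finset.induction_on with
  | empty => simp
  | insert a s ha ih =>
    rw [Finset.prod_insert ha, Finset.prod_insert ha]
    set P := ∏ i ∈ s, f i
    set Q := ∏ i ∈ s, (1 + |f i - 1|)
    have hQ : |P| ≤ Q := by
      have := abs_sub_abs_le_abs_sub P 1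
      rw [abs_one] at this
      linarith
    have h1 : f a * P - 1 = (f a - 1) * P + (P - 1) := by ring
    rw [h1]
    calc |(f a - 1) * P + (P - 1)| ≤ |(f a - 1) * P| + |P - 1| := abs_add_le _ _
      _ = |f a - 1| * |P| + |P - 1| := by rw [abs_mul]
      _ ≤ |f a - 1| * Q + (Q - 1) := add_le_add (mul_le_mul_of_nonneg_left hQ (abs_nonneg _)) ih
      _ = (1 + |f a - 1|) * Q - 1 := by ring

/-- `|∏ fᵢ − 1| ≤ exp(∑ |fᵢ − 1|) − 1`. [folklore] -/
private theorem abs_prod_sub_one_le_exp {ι : Type*} (s : Finset ι) (f : ι → ℝ) :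
    |∏ i ∈ s, f i - 1| ≤ Real.exp (∑ i ∈ s, |f i - 1|) - 1 := by
  refine (abs_prod_sub_one_le s f).trans (sub_le_sub_right ?_ 1)
  rw [Real.exp_sum]
  exact Finset.prod_le_prod (fun i _ => by positivity) fun i _ => by
    have := Real.add_one_le_exp (|f i - 1|); linarith

/-- **`|excProdM − 1| ≤ exp(k · #{p ∣ E : p > N}/N) − 1`** (`N ≥ 1`; each factor is `1 + O(k/p)`).
[cite: Maynard2016DenseClusters, Lemma 8.1 p. 15 (few exceptional primes beyond R, each factor 1 + O(k/p))] -/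
theorem abs_excProdM_sub_one_le {L : Fin (n + 1) → ℤ × ℤ} (hadm : FormsAdmissible L) (m : Fin (n + 1))
    (D : ℕ) {N : ℕ} (hN : 1 ≤ N) (E : ℕ) :
    |excProdM L m D N E - 1| ≤
      Real.exp (((n + 1 : ℕ) : ℝ) * #(E.primeFactors.filter (fun p => N < p)) / N) - 1 := by
  unfold excProdM
  refine (abs_prod_sub_one_le_exp _ _).trans (sub_le_sub_right (Real.exp_le_exp.2 ?_) 1)
  have hN0 : (0 : ℝ) < N := by exact_mod_cast hN
  calc ∑ p ∈ E.primeFactors.filter (fun p => N < p ∧ ¬ p ∣ D), |corrFactorM L m p - 1|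
      ≤ ∑ p ∈ E.primeFactors.filter (fun p => N < p ∧ ¬ p ∣ D), ((n + 1 : ℕ) : ℝ) / N :=
        Finset.sum_le_sum fun p hp => by
          obtain ⟨hpE, hNp, -⟩ := Finset.mem_filter.1 hp
          exact abs_corrFactorM_sub_one_le hadm m (Nat.prime_of_mem_primeFactors hpE) hN hNp
    _ = #(E.primeFactors.filter (fun p => N < p ∧ ¬ p ∣ D)) * (((n + 1 : ℕ) : ℝ) / N) := by
        rw [Finset.sum_const, nsmul_eq_mul]
    _ ≤ #(E.primeFactors.filter (fun p => N < p)) * (((n + 1 : ℕ) : ℝ) / N) := by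
        refine mul_le_mul_of_nonneg_right ?_ (by positivity)
        exact_mod_cast Finset.card_le_card (fun p hp => by
          obtain ⟨hpE, hNp, -⟩ := Finset.mem_filter.1 hp
          exact Finset.mem_filter.2 ⟨hpE, hNp⟩)
    _ = _ := by ring

/-- The `a_m`-correction `∏_{p ∣ a, p ∤ D} p/(p − 1)` (the factors `(1 + ω(p)/φ_ω(p))(1 − 1/p)^{k−1}` of (9.19)
against `𝔖_{WB}`). [cite: Maynard2016DenseClusters, proof of Prop. 9.2 (9.19) p. 23 (∏_{p ∣ a_m, p ∤ WB})] -/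
def aCorr (a D : ℕ) : ℝ := ∏ p ∈ a.primeFactors.filter (fun p => ¬ p ∣ D), (p : ℝ) / ((p : ℝ) - 1)

/-- `∏_{p ∣ a, p ∤ D}(1 − 1/p) · aCorr a D = 1`. [cite: Maynard2016DenseClusters, proof of Prop. 9.2 (9.19)⟹(9.21) p. 23] -/
theorem prod_one_sub_inv_mul_aCorr (a D : ℕ) :
    (∏ p ∈ a.primeFactors.filter (fun p => ¬ p ∣ D), (1 - 1 / (p : ℝ))) * aCorr a D = 1 := by
  unfold aCorr
  rw [← Finset.prod_mul_distrib]
  refine Finset.prod_eq_one fun p hp => ?_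
  have hpp := Nat.prime_of_mem_primeFactors (Finset.mem_filter.1 hp).1
  have hp0 : (p : ℝ) ≠ 0 := by exact_mod_cast hpp.ne_zero
  have hp1 : (p : ℝ) - 1 ≠ 0 := by
    have : (1 : ℝ) < p := by exact_mod_cast hpp.one_lt
    exact (sub_pos.2 this).ne'
  field_simp

/-- `∏_{p ∣ a, p ∤ D}(1 − 1/p) = ∏_{p ∣ a, p ∤ D}(p − 1)/p` (the shape used in `mainCoeffM`). [folklore] -/
private theorem prod_one_sub_inv_eq_prod_div (a D : ℕ) :
    (∏ p ∈ a.primeFactors.filter (fun p => ¬ p ∣ D), (1 - 1 / (p : ℝ))) =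
      ∏ p ∈ a.primeFactors.filter (fun p => ¬ p ∣ D), (((p : ℝ) - 1) / p) :=
  Finset.prod_congr rfl fun p hp => by
    have hp0 : (p : ℝ) ≠ 0 := by
      exact_mod_cast (Nat.prime_of_mem_primeFactors (Finset.mem_filter.1 hp).1).ne_zero
    field_simp

/-! ### The partial products of `𝔖_{WB}(𝓛) · Π'` stabilise -/

/-- **The partial products of `𝔖_{WB}(𝓛)·Π'` stabilise**: for an exceptional modulus `E` (`ω(p) = k` and
`p ∤ a_j b_m − a_m b_j ∀ j ≠ m` for every prime `p ∤ E`), `|a_m| ≤ ⌊R⌋` and `y ≥ max(WB, E, |a_m|)`,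
`𝔖_{WB}(𝓛; p ≤ y) · Π'(p ≤ y) = (φ(WB)/WB)^{k−1} · ∏_{p∣a_m,p∤WB} p/(p−1) · excProdM`: at `p ∣ WB` the factor
of `Π'` is `(1 − 1/p)^{k−1}` (`n(p) = 0`); at `p ∤ WB`, `p ≤ ⌊R⌋` the product of the two local factors is `1`
if `p ∤ a_m` (`n(p) = ω(p) − 1`) and `p/(p−1)` if `p ∣ a_m` (`n(p) = ω(p)`); beyond `⌊R⌋` it is `corrFactorM`,
which is `1` off `E`.
[cite: Maynard2016DenseClusters, proof of Prop. 9.2 (9.19)⟹(9.21) p. 23; p. 21 (W'_j); Lemma 8.4 p. 16] -/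
theorem singPartial_mul_piPartialM_eq {L : Fin (n + 1) → ℤ × ℤ} (hadm : FormsAdmissible L) {B : ℕ}
    (hB : B ≠ 0) {R : ℝ} (m : Fin (n + 1)) (haR : (L m).1.natAbs ≤ ⌊R⌋₊) {E : ℕ} (hE0 : E ≠ 0)
    (hE : ∀ p : ℕ, p.Prime → ¬ p ∣ E →
      omegaL L p = n + 1 ∧ ∀ j : Fin n, ¬ p ∣ (crossDet L m (m.succAbove j)).natAbs)
    {y : ℕ} (hyW : wCut (n + 1) B * B ≤ y) (hyE : E ≤ y) (hya : (L m).1.natAbs ≤ y) :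
    singPartial L (wCut (n + 1) B * B) y *
        MaynardDense.piPartial n (idxModM L B R m) (fun p => (p : ℝ) - omegaL L p) (y + 1) =
      ((Nat.totient (wCut (n + 1) B * B) : ℝ) / (wCut (n + 1) B * B : ℕ)) ^ n *
        (aCorr (L m).1.natAbs (wCut (n + 1) B * B) * excProdM L m (wCut (n + 1) B * B) ⌊R⌋₊ E) := by
  classical
  have hD0 : wCut (n + 1) B * B ≠ 0 := Nat.mul_ne_zero (wCut_ne_zero (n + 1) B) hB
  have ha0 : (L m).1.natAbs ≠ 0 := Int.natAbs_ne_zero.2 (hadm.1 m)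
  have hω : ∀ p, p.Prime → omegaL L p < p := fun p hp => ((formsAdmissible_iff_omegaL L).1 hadm).2 p hp
  set T := (Finset.range (y + 1)).filter Nat.Prime with hT
  have hpb : Nat.primesBelow (y + 1) = T := by
    ext p; rw [Nat.mem_primesBelow, hT, Finset.mem_filter, Finset.mem_range]
  have hmemT : ∀ {p : ℕ}, p ∈ T ↔ p < y + 1 ∧ p.Prime := fun {p} => by
    rw [hT, Finset.mem_filter, Finset.mem_range]
  have hsing : singPartial L (wCut (n + 1) B * B) y =
      ∏ p ∈ T.filter (fun p => ¬ p ∣ wCut (n + 1) B * B), singFactor L p := by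
    unfold singPartial
    refine Finset.prod_congr ?_ fun _ _ => rfl
    ext p
    simp only [hT, Finset.mem_filter, Finset.mem_range, and_assoc]
  -- the piecewise local factor
  set g : ℕ → ℝ := fun p => if p ∣ wCut (n + 1) B * B then (1 - 1 / (p : ℝ)) ^ n else
    if p ≤ ⌊R⌋₊ then (if p ∣ (L m).1.natAbs then (p : ℝ) / ((p : ℝ) - 1) else 1)
    else corrFactorM L m p with hg
  -- Step 1: one product over `T`
  have hprod : singPartial L (wCut (n + 1) B * B) y *
      MaynardDense.piPartial n (idxModM L B R m) (fun p => (p : ℝ) - omegaL L p) (y + 1) =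
      ∏ p ∈ T, g p := by
    rw [hsing, MaynardDense.piPartial, hpb, Finset.prod_filter, ← Finset.prod_mul_distrib]
    refine Finset.prod_congr rfl fun p hp => ?_
    have hpp : p.Prime := (hmemT.1 hp).2
    have hp1 : (p : ℝ) - 1 ≠ 0 := by
      have : (1 : ℝ) < p := by exact_mod_cast hpp.one_lt
      exact (sub_pos.2 this).ne'
    show (if ¬ p ∣ wCut (n + 1) B * B then singFactor L p else 1) *
        ((1 + (MaynardDense.nW n (idxModM L B R m) p : ℝ) / ((p : ℝ) - omegaL L p)) *
          (1 - 1 / (p : ℝ)) ^ n) = g p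
    by_cases hpD : p ∣ wCut (n + 1) B * B
    · rw [if_neg (not_not.2 hpD), hg]; dsimp only; rw [if_pos hpD, nW_idxModM_eq_zero L R m hpD]
      simp
    · rw [if_pos hpD, hg]; dsimp only; rw [if_neg hpD]
      by_cases hpR : p ≤ ⌊R⌋₊
      · rw [if_pos hpR, nW_idxModM_eq_card_admIdxM m hpp hpD hpR,
          singFactor_mul_piFactor_eq_div L hpp.two_le (hω p hpp)]
        have hcard := card_admIdxM_add hadm m hpp
        by_cases hpa : p ∣ (L m).1.natAbs
        · rw [if_pos hpa]
          rw [if_pos hpa, add_zero] at hcard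
          rw [hcard]
          congr 1; ring
        · rw [if_neg hpa]
          rw [if_neg hpa] at hcard
          have h1 : ((#(admIdxM L m p) : ℕ) : ℝ) = omegaL L p - 1 := by
            have h := congrArg (fun t : ℕ => (t : ℝ)) hcard
            push_cast at h
            linarith
          rw [h1, div_eq_one_iff_eq hp1]
          ring
      · rw [if_neg hpR, nW_idxModM_eq_of_lt L B R m hpp hpD (lt_of_not_ge hpR),
          singFactor_mul_piFactor_eq_div L hpp.two_le (hω p hpp)]
        rfl
  -- Step 2: split `T` according to `p ∣ WB`, then `p ≤ ⌊R⌋`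
  rw [hprod, ← Finset.prod_filter_mul_prod_filter_not T (fun p => p ∣ wCut (n + 1) B * B)]
  congr 1
  · have hTD : T.filter (fun p => p ∣ wCut (n + 1) B * B) = (wCut (n + 1) B * B).primeFactors := by
      ext p
      rw [Finset.mem_filter, hmemT, Nat.mem_primeFactors]
      constructor
      · rintro ⟨⟨-, hpp⟩, hpd⟩; exact ⟨hpp, hpd, hD0⟩
      · rintro ⟨hpp, hpd, -⟩
        exact ⟨⟨Nat.lt_succ_of_le ((Nat.le_of_dvd (Nat.pos_of_ne_zero hD0) hpd).trans hyW), hpp⟩, hpd⟩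
    rw [hTD, ← prod_primeFactors_one_sub_inv_pow_eq hD0 n]
    exact Finset.prod_congr rfl fun p hp => by
      rw [hg]; dsimp only; rw [if_pos (Nat.dvd_of_mem_primeFactors hp)]
  · rw [← Finset.prod_filter_mul_prod_filter_not (T.filter fun p => ¬ p ∣ wCut (n + 1) B * B)
      (fun p => p ≤ ⌊R⌋₊)]
    congr 1
    · -- primes `p ≤ ⌊R⌋`, `p ∤ WB`: the factor is `p/(p−1)` exactly at `p ∣ a_m`
      unfold aCorr
      rw [← Finset.prod_filter_mul_prod_filter_not
        ((T.filter fun p => ¬ p ∣ wCut (n + 1) B * B).filter fun p => p ≤ ⌊R⌋₊)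
        (fun p => p ∣ (L m).1.natAbs)]
      have hS : ((T.filter fun p => ¬ p ∣ wCut (n + 1) B * B).filter fun p => p ≤ ⌊R⌋₊).filter
          (fun p => p ∣ (L m).1.natAbs) =
          (L m).1.natAbs.primeFactors.filter (fun p => ¬ p ∣ wCut (n + 1) B * B) := by
        ext p
        simp only [Finset.mem_filter, hmemT, Nat.mem_primeFactors]
        constructor
        · rintro ⟨⟨⟨⟨-, hpp⟩, hpD⟩, -⟩, hpa⟩; exact ⟨⟨hpp, hpa, ha0⟩, hpD⟩
        · rintro ⟨⟨hpp, hpa, -⟩, hpD⟩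
          have hple : p ≤ (L m).1.natAbs := Nat.le_of_dvd (Nat.pos_of_ne_zero ha0) hpa
          exact ⟨⟨⟨⟨Nat.lt_succ_of_le (hple.trans hya), hpp⟩, hpD⟩, hple.trans haR⟩, hpa⟩
      rw [hS, Finset.prod_eq_one (s := (((T.filter fun p => ¬ p ∣ wCut (n + 1) B * B).filter
        fun p => p ≤ ⌊R⌋₊).filter fun p => ¬ p ∣ (L m).1.natAbs)), mul_one]
      · refine Finset.prod_congr rfl fun p hp => ?_
        obtain ⟨⟨hpp, hpa, -⟩, hpD⟩ := by
          have h := hp; rw [Finset.mem_filter, Nat.mem_primeFactors] at h; exact h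
        have hple : p ≤ ⌊R⌋₊ := (Nat.le_of_dvd (Nat.pos_of_ne_zero ha0) hpa).trans haR
        rw [hg]; dsimp only; rw [if_neg hpD, if_pos hple, if_pos hpa]
      · intro p hp
        simp only [Finset.mem_filter] at hp
        obtain ⟨⟨⟨-, hpD⟩, hpR⟩, hpa⟩ := hp
        rw [hg]; dsimp only; rw [if_neg hpD, if_pos hpR, if_neg hpa]
    · -- primes `p > ⌊R⌋`, `p ∤ WB`: `corrFactorM`, which is `1` off `E`
      unfold excProdM
      have hS : E.primeFactors.filter (fun p => ⌊R⌋₊ < p ∧ ¬ p ∣ wCut (n + 1) B * B) ⊆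
          (T.filter fun p => ¬ p ∣ wCut (n + 1) B * B).filter (fun p => ¬ p ≤ ⌊R⌋₊) := by
        intro p hp
        obtain ⟨hpE, hpR, hpD⟩ := Finset.mem_filter.1 hp
        obtain ⟨hpp, hpd, -⟩ := Nat.mem_primeFactors.1 hpE
        simp only [Finset.mem_filter, hmemT]
        exact ⟨⟨⟨Nat.lt_succ_of_le ((Nat.le_of_dvd (Nat.pos_of_ne_zero hE0) hpd).trans hyE), hpp⟩, hpD⟩,
          not_le.2 hpR⟩
      rw [← Finset.prod_subset hS ?_]
      · refine Finset.prod_congr rfl fun p hp => ?_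
        obtain ⟨-, hpR, hpD⟩ := Finset.mem_filter.1 hp
        rw [hg]; dsimp only; rw [if_neg hpD, if_neg (not_le.2 hpR)]
      · intro p hpT hpS
        simp only [Finset.mem_filter, hmemT] at hpT
        obtain ⟨⟨⟨-, hpp⟩, hpD⟩, hpR⟩ := hpT
        rw [hg]; dsimp only; rw [if_neg hpD, if_neg hpR]
        have hpE : ¬ p ∣ E := fun h =>
          hpS (Finset.mem_filter.2 ⟨Nat.mem_primeFactors.2 ⟨hpp, h, hE0⟩, lt_of_not_ge hpR, hpD⟩)
        obtain ⟨hωk, hΔ⟩ := hE p hpp hpE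
        exact corrFactorM_eq_one hpp.one_lt hωk hΔ

/-! ### The moduli `W'_j`: size facts for Lemma 8.4 -/

/-- `W'_j ≠ 0` (`B ≠ 0`, non-degenerate `𝓛`). [cite: Maynard2016DenseClusters, proof of Prop. 9.2 (9.8) p. 21] -/
theorem idxModM_ne_zero {L : Fin (n + 1) → ℤ × ℤ} (hnd : FormsNondegenerate L) {B : ℕ} (hB : B ≠ 0)
    (R : ℝ) (m : Fin (n + 1)) (j : Fin n) : idxModM L B R m j ≠ 0 := by
  unfold idxModM
  refine Nat.mul_ne_zero (idxMod_ne_zero L hB R _) ?_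
  rw [ne_eq, Int.natAbs_eq_zero]
  unfold crossDet
  intro h
  exact hnd _ _ (Fin.succAbove_ne m j) (sub_eq_zero.1 h)

/-- Every prime `p ≤ 2k²` divides `W'_j` (it divides `W` or `B`). [cite: Maynard2016DenseClusters, Lemma 8.4 (hypothesis on W_i) p. 16] -/
theorem dvd_idxModM_of_le (L : Fin (n + 1) → ℤ × ℤ) (B : ℕ) (R : ℝ) (m : Fin (n + 1)) (j : Fin n) {p : ℕ}
    (hp : p.Prime) (hple : p ≤ 2 * (n + 1) ^ 2) : p ∣ idxModM L B R m j := by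
  unfold idxModM
  exact (dvd_idxMod_of_le L B R _ hp hple).mul_right _

/-- `Δ*_m = ∏_{j ≠ m} |a_j b_m − a_m b_j| ≥ 1` for non-degenerate `𝓛` (indexed along `m.succAbove`).
[cite: Maynard2016DenseClusters, proof of Lemma 9.3 p. 24; FordGreenKonyaginMaynardTao2018, §7 p. 20] -/
theorem one_le_prod_crossDet_natAbs {L : Fin (n + 1) → ℤ × ℤ} (hnd : FormsNondegenerate L) (m : Fin (n + 1)) :
    1 ≤ ∏ j : Fin n, (crossDet L m (m.succAbove j)).natAbs := by
  refine Finset.one_le_prod' fun j _ => Nat.one_le_iff_ne_zero.2 ?_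
  rw [ne_eq, Int.natAbs_eq_zero]
  unfold crossDet
  intro h
  exact hnd _ _ (Fin.succAbove_ne m j) (sub_eq_zero.1 h)

/-- `W'_j ≤ W B E Δ*_m` for an exceptional modulus `E` of `𝓛` (`ω(p) = k` off `E`).
[cite: Maynard2016DenseClusters, Lemma 8.1(ii) p. 15, proof of Prop. 9.2 (9.8) p. 21] -/
theorem idxModM_le {L : Fin (n + 1) → ℤ × ℤ} (hadm : FormsAdmissible L) (hnd : FormsNondegenerate L)
    (B : ℕ) (R : ℝ) (m : Fin (n + 1)) {E : ℕ} (hE0 : E ≠ 0)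
    (hE : ∀ p : ℕ, p.Prime → ¬ p ∣ E → omegaL L p = n + 1) (j : Fin n) :
    idxModM L B R m j ≤ wCut (n + 1) B * B * (E * ∏ i : Fin n, (crossDet L m (m.succAbove i)).natAbs) := by
  unfold idxModM
  have h1 := idxMod_le_mul_exceptional hadm B R (m.succAbove j) hE0 hE
  have h2 : (crossDet L m (m.succAbove j)).natAbs ≤ ∏ i : Fin n, (crossDet L m (m.succAbove i)).natAbs :=
    Finset.single_le_prod' (f := fun i : Fin n => (crossDet L m (m.succAbove i)).natAbs)
      (fun i _ => Nat.one_le_iff_ne_zero.2 (by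
        rw [ne_eq, Int.natAbs_eq_zero]; unfold crossDet; intro h
        exact hnd _ _ (Fin.succAbove_ne m i) (sub_eq_zero.1 h))) (Finset.mem_univ j)
  calc idxMod L B R (m.succAbove j) * (crossDet L m (m.succAbove j)).natAbs
      ≤ (wCut (n + 1) B * B * E) * ∏ i : Fin n, (crossDet L m (m.succAbove i)).natAbs :=
        Nat.mul_le_mul h1 h2
    _ = _ := by ring

/-! ### `Π'` identified -/

/-- **`𝔖_{WB}(𝓛) · Π' = (φ(WB)/WB)^{k−1} · ∏_{p∣a_m,p∤WB} p/(p−1) · excProdM`** (`k = n + 1 ≥ 2`; the limit of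
`singPartial_mul_piPartialM_eq`, the partial products of `Π'` converging by Lemma 8.4's product lemma with
`K₀ = k`, `K₁ = 2k − 1`). [cite: Maynard2016DenseClusters, proof of Prop. 9.2 (9.19)⟹(9.21) p. 23; Lemma 8.4 (Π_g) p. 16] -/
theorem singSeriesExcl_mul_piRecM_eq (hn : 2 ≤ n + 1) {L : Fin (n + 1) → ℤ × ℤ} (hadm : FormsAdmissible L)
    (hnd : FormsNondegenerate L) {B : ℕ} (hB : B ≠ 0) {R : ℝ} (m : Fin (n + 1))
    (haR : (L m).1.natAbs ≤ ⌊R⌋₊) {E : ℕ} (hE0 : E ≠ 0)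
    (hE : ∀ p : ℕ, p.Prime → ¬ p ∣ E →
      omegaL L p = n + 1 ∧ ∀ j : Fin n, ¬ p ∣ (crossDet L m (m.succAbove j)).natAbs) :
    singSeriesExcl L (wCut (n + 1) B * B) *
        MaynardDense.piRec n (idxModM L B R m) (fun p => (p : ℝ) - omegaL L p) =
      ((Nat.totient (wCut (n + 1) B * B) : ℝ) / (wCut (n + 1) B * B : ℕ)) ^ n *
        (aCorr (L m).1.natAbs (wCut (n + 1) B * B) * excProdM L m (wCut (n + 1) B * B) ⌊R⌋₊ E) := by
  have hω : ∀ p, p.Prime → omegaL L p < p := fun p hp => ((formsAdmissible_iff_omegaL L).1 hadm).2 p hp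
  have hk' : (2 : ℝ) ≤ ((n + 1 : ℕ) : ℝ) := by exact_mod_cast hn
  have hT1 : Tendsto (MaynardDense.piPartial n (idxModM L B R m) (fun p => (p : ℝ) - omegaL L p)) atTop
      (𝓝 (MaynardDense.piRec n (idxModM L B R m) (fun p => (p : ℝ) - omegaL L p))) := by
    refine MaynardDense.tendsto_piPartial_dec n (idxModM L B R m) ((n + 1 : ℕ) : ℝ)
      (2 * ((n + 1 : ℕ) : ℝ) - 1) _ hk' (by nlinarith) (fun i => idxModM_ne_zero hnd hB R m i)
      (fun i p hp hple => ?_) (fun p hp => ?_) (fun p hp => ?_)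
    · have : p ≤ 2 * (n + 1) ^ 2 := by exact_mod_cast hple
      exact dvd_idxModM_of_le L B R m i hp this
    · have : ((omegaL L p : ℕ) : ℝ) < p := by exact_mod_cast hω p hp
      show (0 : ℝ) < (p : ℝ) - omegaL L p
      linarith
    · have h1 : ((omegaL L p : ℕ) : ℝ) ≤ ((n + 1 : ℕ) : ℝ) := by
        exact_mod_cast omegaL_le_card_of_admissible hadm hp
      show |1 + ((p : ℝ) - omegaL L p) - p| + (n : ℝ) ≤ 2 * ((n + 1 : ℕ) : ℝ) - 1
      rw [show (1 : ℝ) + ((p : ℝ) - omegaL L p) - p = 1 - omegaL L p by ring]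
      push_cast at h1 ⊢
      rcases Nat.eq_zero_or_pos (omegaL L p) with h0 | hpos
      · rw [h0, Nat.cast_zero, sub_zero, abs_one]
        have : (0 : ℝ) ≤ n := Nat.cast_nonneg n
        linarith
      · have : (1 : ℝ) ≤ omegaL L p := by exact_mod_cast hpos
        rw [abs_of_nonpos (by linarith)]
        linarith
  have hT := (tendsto_singPartial_of_nondegenerate hadm hnd (wCut (n + 1) B * B)).mul
    (hT1.comp (tendsto_add_atTop_nat 1))
  have hconst : (fun _ : ℕ => ((Nat.totient (wCut (n + 1) B * B) : ℝ) / (wCut (n + 1) B * B : ℕ)) ^ n *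
        (aCorr (L m).1.natAbs (wCut (n + 1) B * B) * excProdM L m (wCut (n + 1) B * B) ⌊R⌋₊ E)) =ᶠ[atTop]
      fun y => singPartial L (wCut (n + 1) B * B) y *
        (MaynardDense.piPartial n (idxModM L B R m) (fun p => (p : ℝ) - omegaL L p) ∘ fun a => a + 1) y := by
    filter_upwards [eventually_ge_atTop (max (wCut (n + 1) B * B) (max E (L m).1.natAbs))] with y hy
    rw [Function.comp_apply, singPartial_mul_piPartialM_eq hadm hB m haR hE0 hE (le_of_max_le_left hy)
      (le_of_max_le_left (le_of_max_le_right hy)) (le_of_max_le_right (le_of_max_le_right hy))]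
  exact tendsto_nhds_unique hT (tendsto_const_nhds.congr' hconst)

/-- **`c_m = (WB)^{k−1} 𝔖_{WB}(𝓛)/φ(WB)^{k−1} · ∏_{p ∣ a_m, p ∤ WB}(1 − 1/p)`** (from `c_m = yPref · φ(a_mWB)/(a_mWB)`
and `φ(a W) = a φ(W) ∏_{p∣a,p∤W}(1 − 1/p)`). [cite: Maynard2016DenseClusters, Lemma 9.3 (9.14) p. 21, (9.19)–(9.21) p. 23] -/
theorem cM_eq_prefactor_mul {L : Fin (n + 1) → ℤ × ℤ} {m : Fin (n + 1)} (hLm : (L m).1 ≠ 0) {B : ℕ}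
    (hB : B ≠ 0) :
    cM L B m = ((wCut (n + 1) B * B : ℕ) : ℝ) ^ n / (Nat.totient (wCut (n + 1) B * B) : ℝ) ^ n *
      singSeriesExcl L (wCut (n + 1) B * B) *
      ∏ p ∈ (L m).1.natAbs.primeFactors.filter (fun p => ¬ p ∣ wCut (n + 1) B * B), (1 - 1 / (p : ℝ)) := by
  have hD0 : wCut (n + 1) B * B ≠ 0 := Nat.mul_ne_zero (wCut_ne_zero (n + 1) B) hB
  have ha0 : (L m).1.natAbs ≠ 0 := Int.natAbs_ne_zero.2 hLm
  rw [cM_eq_yPref_mul (by omega) L B m, yPref, cast_totient_mul_eq_prod_filter ha0 hD0]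
  have hDpos : (0 : ℝ) < ((wCut (n + 1) B * B : ℕ) : ℝ) := by exact_mod_cast Nat.pos_of_ne_zero hD0
  have hφpos : (0 : ℝ) < (Nat.totient (wCut (n + 1) B * B) : ℝ) := by
    exact_mod_cast Nat.totient_pos.2 (Nat.pos_of_ne_zero hD0)
  have hapos : (0 : ℝ) < ((L m).1.natAbs : ℝ) := by exact_mod_cast Nat.pos_of_ne_zero ha0
  have hW0 : ((wCut (n + 1) B : ℕ) : ℝ) ≠ 0 := by exact_mod_cast wCut_ne_zero (n + 1) B
  have hB0 : ((B : ℕ) : ℝ) ≠ 0 := by exact_mod_cast hB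
  push_cast
  field_simp
  ring

/-- **`c_m² · Π' = (WB)^{k−1}/φ(WB)^{k−1} · 𝔖_{WB}(𝓛) · ∏_{p∣a_m,p∤WB}(p−1)/p · excProdM`** (`k = n + 1 ≥ 2`,
`|a_m| ≤ ⌊R⌋`): the product of (9.19) «simplified» to the constant of (9.21), up to the factor `excProdM`
(`= 1 + O(1/log X)` in the frame). [cite: Maynard2016DenseClusters, proof of Prop. 9.2 (9.19)⟹(9.21) p. 23] -/
theorem cM_sq_mul_piRec_eq (hn : 2 ≤ n + 1) {L : Fin (n + 1) → ℤ × ℤ} (hadm : FormsAdmissible L)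
    (hnd : FormsNondegenerate L) {B : ℕ} (hB : B ≠ 0) {R : ℝ} (m : Fin (n + 1))
    (haR : (L m).1.natAbs ≤ ⌊R⌋₊) {E : ℕ} (hE0 : E ≠ 0)
    (hE : ∀ p : ℕ, p.Prime → ¬ p ∣ E →
      omegaL L p = n + 1 ∧ ∀ j : Fin n, ¬ p ∣ (crossDet L m (m.succAbove j)).natAbs) :
    cM L B m ^ 2 * MaynardDense.piRec n (idxModM L B R m) (fun p => (p : ℝ) - omegaL L p) =
      ((wCut (n + 1) B * B : ℕ) : ℝ) ^ n / (Nat.totient (wCut (n + 1) B * B) : ℝ) ^ n *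
        singSeriesExcl L (wCut (n + 1) B * B) *
        (∏ p ∈ (L m).1.natAbs.primeFactors.filter (fun p => ¬ p ∣ wCut (n + 1) B * B), (((p : ℝ) - 1) / p)) *
        excProdM L m (wCut (n + 1) B * B) ⌊R⌋₊ E := by
  have hD0 : wCut (n + 1) B * B ≠ 0 := Nat.mul_ne_zero (wCut_ne_zero (n + 1) B) hB
  set P := ((wCut (n + 1) B * B : ℕ) : ℝ) ^ n / (Nat.totient (wCut (n + 1) B * B) : ℝ) ^ n with hP
  set S := singSeriesExcl L (wCut (n + 1) B * B) with hS
  set Q := ∏ p ∈ (L m).1.natAbs.primeFactors.filter (fun p => ¬ p ∣ wCut (n + 1) B * B),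
    (1 - 1 / (p : ℝ)) with hQ
  have hcM : cM L B m = P * S * Q := cM_eq_prefactor_mul (hadm.1 m) hB
  have hlim := singSeriesExcl_mul_piRecM_eq hn hadm hnd hB m haR hE0 hE
  have hQa : Q * aCorr (L m).1.natAbs (wCut (n + 1) B * B) = 1 := prod_one_sub_inv_mul_aCorr _ _
  have hQ' := prod_one_sub_inv_eq_prod_div (L m).1.natAbs (wCut (n + 1) B * B)
  have hDpos : (0 : ℝ) < ((wCut (n + 1) B * B : ℕ) : ℝ) := by exact_mod_cast Nat.pos_of_ne_zero hD0
  have hφpos : (0 : ℝ) < (Nat.totient (wCut (n + 1) B * B) : ℝ) := by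
    exact_mod_cast Nat.totient_pos.2 (Nat.pos_of_ne_zero hD0)
  have hPinv : P * (((Nat.totient (wCut (n + 1) B * B) : ℝ) / (wCut (n + 1) B * B : ℕ)) ^ n) = 1 := by
    rw [hP, div_pow]
    field_simp
  calc cM L B m ^ 2 * MaynardDense.piRec n (idxModM L B R m) (fun p => (p : ℝ) - omegaL L p)
      = (P * S * Q) ^ 2 * MaynardDense.piRec n (idxModM L B R m) (fun p => (p : ℝ) - omegaL L p) := by
        rw [hcM]
    _ = P * S * Q * (P * Q) *
        (S * MaynardDense.piRec n (idxModM L B R m) (fun p => (p : ℝ) - omegaL L p)) := by ring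
    _ = P * S * Q * (P * Q) * (((Nat.totient (wCut (n + 1) B * B) : ℝ) / (wCut (n + 1) B * B : ℕ)) ^ n *
        (aCorr (L m).1.natAbs (wCut (n + 1) B * B) * excProdM L m (wCut (n + 1) B * B) ⌊R⌋₊ E)) := by
        rw [hlim]
    _ = P * S * Q * excProdM L m (wCut (n + 1) B * B) ⌊R⌋₊ E *
        (P * (((Nat.totient (wCut (n + 1) B * B) : ℝ) / (wCut (n + 1) B * B : ℕ)) ^ n)) *
        (Q * aCorr (L m).1.natAbs (wCut (n + 1) B * B)) := by ring
    _ = P * S * Q * excProdM L m (wCut (n + 1) B * B) ⌊R⌋₊ E := by rw [hPinv, hQa, mul_one, mul_one]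
    _ = _ := by rw [hQ, hQ']

/-- **`(log R · c_m)² · Π' (log R)^{k−1} J = mainCoeffM 𝓛 B R J m · excProdM`** (`k = n + 1 ≥ 2`, `|a_m| ≤ ⌊R⌋`):
the main term of (9.19) in the shape (9.21), `mainCoeffM = (log R)^{k+1} W^{k−1}B^{k−1}𝔖_{WB}(𝓛)/φ(WB)^{k−1}
· ∏_{p∣a_m,p∤WB}(p−1)/p · J`. [cite: Maynard2016DenseClusters, proof of Prop. 9.2 (9.19)–(9.21) p. 23; FordGreenKonyaginMaynardTao2018, Thm 6 (7.13) p. 21] -/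
theorem logR_cM_sq_mul_piRec_eq_mainCoeffM (hn : 2 ≤ n + 1) {L : Fin (n + 1) → ℤ × ℤ}
    (hadm : FormsAdmissible L) (hnd : FormsNondegenerate L) {B : ℕ} (hB : B ≠ 0) {R : ℝ}
    (m : Fin (n + 1)) (haR : (L m).1.natAbs ≤ ⌊R⌋₊) {E : ℕ} (hE0 : E ≠ 0)
    (hE : ∀ p : ℕ, p.Prime → ¬ p ∣ E →
      omegaL L p = n + 1 ∧ ∀ j : Fin n, ¬ p ∣ (crossDet L m (m.succAbove j)).natAbs) (J : ℝ) :
    (Real.log R * cM L B m) ^ 2 *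
        (MaynardDense.piRec n (idxModM L B R m) (fun p => (p : ℝ) - omegaL L p) * Real.log R ^ n * J) =
      mainCoeffM L B R J m * excProdM L m (wCut (n + 1) B * B) ⌊R⌋₊ E := by
  unfold mainCoeffM
  simp only [Nat.add_sub_cancel]
  rw [show (Real.log R * cM L B m) ^ 2 *
      (MaynardDense.piRec n (idxModM L B R m) (fun p => (p : ℝ) - omegaL L p) * Real.log R ^ n * J) =
      (cM L B m ^ 2 * MaynardDense.piRec n (idxModM L B R m) (fun p => (p : ℝ) - omegaL L p)) *
        (Real.log R ^ (n + 1 + 1) * J) by ring, cM_sq_mul_piRec_eq hn hadm hnd hB m haR hE0 hE]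
  ring

/-! ### In the frame of Proposition 6.1: `Π'` gives `mainCoeffM · (1 + O(1/log X))` -/

set_option maxHeartbeats 400000 in
/-- **`Π'` in the frame of Prop. 6.1 / [FGKMT, Thm 6]** (the ranges `B = 1` or prime, `2 ≤ k ≤ (log x)^{1/5}`,
admissible non-degenerate `𝓛` with `|aᵢ| ≤ log x`, `|bᵢ| ≤ x log²x`, `x/2 ≤ X ≤ x log²x`, `X^{1/30} ≤ R ≤ X^{1/9}`,
written with `k = n + 1`): for all large `x` and every `m` there is an exceptional modulus `E' ≥ 1` (off which
`ω(p) = k` and `p ∤ a_j b_m − a_m b_j`) with `log E' ≤ 20 k² log X` and `W'_j ≤ W B E'` for all `j`, and a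
number `c = excProdM` with `|c − 1| ≤ 1/log X` such that
`(log R · c_m)² · Π' (log R)^{k−1} J = mainCoeffM 𝓛 B R J m · c` for every `J` — i.e. (9.19) ⟹ (9.21):
«the errors appearing are o((log x)^{−1/10}) … simplifying the products gives (9.21)».
[cite: Maynard2016DenseClusters, proof of Prop. 9.2 (9.19)–(9.21) p. 23, Lemma 8.1 p. 15; FordGreenKonyaginMaynardTao2018, Thm 6 (7.13) pp. 21–22] -/
theorem prop92_piRecM_eventually :
    ∀ᶠ x : ℕ in atTop, ∀ B : ℕ, (B = 1 ∨ B.Prime) → B ≤ x →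
      ∀ (n : ℕ) (L : Fin (n + 1) → ℤ × ℤ) (X R : ℝ), 2 ≤ n + 1 →
        ((n + 1 : ℕ) : ℝ) ≤ Real.log x ^ ((1 : ℝ) / 5) → FormsAdmissible L → FormsNondegenerate L →
        (∀ i, |(((L i).1 : ℤ) : ℝ)| ≤ Real.log x ∧ |(((L i).2 : ℤ) : ℝ)| ≤ x * Real.log x ^ 2) →
        (x : ℝ) / 2 ≤ X → X ≤ x * Real.log x ^ 2 → X ^ ((1 : ℝ) / 30) ≤ R → R ≤ X ^ ((1 : ℝ) / 9) →
        ∀ m : Fin (n + 1), (L m).1.natAbs ≤ ⌊R⌋₊ ∧ ∃ E : ℕ, 1 ≤ E ∧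
          (∀ p : ℕ, p.Prime → ¬ p ∣ E →
            omegaL L p = n + 1 ∧ ∀ j : Fin n, ¬ p ∣ (crossDet L m (m.succAbove j)).natAbs) ∧
          Real.log E ≤ 20 * ((n + 1 : ℕ) : ℝ) ^ 2 * Real.log X ∧
          (∀ j : Fin n, idxModM L B R m j ≤ wCut (n + 1) B * B * E) ∧
          |excProdM L m (wCut (n + 1) B * B) ⌊R⌋₊ E - 1| ≤ 1 / Real.log X ∧
          ∀ J : ℝ, (Real.log R * cM L B m) ^ 2 *
              (MaynardDense.piRec n (idxModM L B R m) (fun p => (p : ℝ) - omegaL L p) *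
                Real.log R ^ n * J) =
            mainCoeffM L B R J m * excProdM L m (wCut (n + 1) B * B) ⌊R⌋₊ E := by
  filter_upwards [eventually_excProd_aux, eventually_ge_atTop 3] with x hx hx3 B hB hBx n L X R hn hk
    hadm hnd hcoef hX1 hX2 hR1 hR2 m
  obtain ⟨hN2, hℓX, hXℓ, hlogX1, hmain⟩ := hx (n + 1) hk X R hX1 hX2 hR1
  have hB0 : B ≠ 0 := hB.elim (fun h => by rw [h]; exact one_ne_zero) fun h => h.ne_zero
  have hx3' : (3 : ℝ) ≤ x := by exact_mod_cast hx3
  have hx0 : (0 : ℝ) < x := by linarith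
  set ℓ := Real.log (x : ℝ) with hℓ
  have hℓ1 : 1 ≤ ℓ := by
    rw [hℓ, Real.le_log_iff_exp_le (by linarith)]
    exact (Real.exp_one_lt_d9.le.trans (by norm_num)).trans hx3'
  have hℓ0 : 0 ≤ ℓ := zero_le_one.trans hℓ1
  have hℓx : ℓ ≤ x := Real.log_le_self hx0.le
  set κ : ℝ := ((n + 1 : ℕ) : ℝ) with hκ
  have hk0 : (0 : ℝ) ≤ κ := by rw [hκ]; exact Nat.cast_nonneg _
  have hk2r : (2 : ℝ) ≤ κ := by rw [hκ]; exact_mod_cast hn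
  -- the exceptional modulus of Lemma 8.1 with `M = 2x log³x`, times `Δ*_m`
  set M := 2 * (x : ℝ) * ℓ ^ 3 with hM
  have hM1 : 1 ≤ M := by
    have : (1 : ℝ) ≤ ℓ ^ 3 := one_le_pow₀ hℓ1
    rw [hM]; nlinarith
  have haM : ∀ i, |(((L i).1 : ℤ) : ℝ)| ≤ M := by
    intro i
    refine (hcoef i).1.trans ?_
    have : ℓ ^ 3 = ℓ * ℓ ^ 2 := by ring
    have h2 : (1 : ℝ) ≤ ℓ ^ 2 := one_le_pow₀ hℓ1
    rw [hM]; nlinarith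
  have hcM : ∀ i j, i ≠ j →
      |(((L i).1 : ℤ) : ℝ) * (((L j).2 : ℤ) : ℝ) - (((L j).1 : ℤ) : ℝ) * (((L i).2 : ℤ) : ℝ)| ≤ M := by
    intro i j _
    have h1 := abs_sub (((((L i).1 : ℤ) : ℝ)) * (((L j).2 : ℤ) : ℝ))
      ((((L j).1 : ℤ) : ℝ) * (((L i).2 : ℤ) : ℝ))
    rw [abs_mul, abs_mul] at h1
    have hi := hcoef i
    have hj := hcoef j
    have e1 : |(((L i).1 : ℤ) : ℝ)| * |(((L j).2 : ℤ) : ℝ)| ≤ ℓ * (x * ℓ ^ 2) :=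
      mul_le_mul hi.1 hj.2 (abs_nonneg _) hℓ0
    have e2 : |(((L j).1 : ℤ) : ℝ)| * |(((L i).2 : ℤ) : ℝ)| ≤ ℓ * (x * ℓ ^ 2) :=
      mul_le_mul hj.1 hi.2 (abs_nonneg _) hℓ0
    calc _ ≤ ℓ * (x * ℓ ^ 2) + ℓ * (x * ℓ ^ 2) := h1.trans (add_le_add e1 e2)
      _ = M := by rw [hM]; ring
  obtain ⟨E, hE1, hE, hEle⟩ := exists_exceptional_modulus hadm hnd hM1 haM hcM
  have hE0 : E ≠ 0 := by omega
  set D : ℕ := ∏ j : Fin n, (crossDet L m (m.succAbove j)).natAbs with hDdef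
  have hD1 : 1 ≤ D := one_le_prod_crossDet_natAbs hnd m
  have hD0 : D ≠ 0 := by omega
  set E' : ℕ := E * D with hE'def
  have hE'1 : 1 ≤ E' := Nat.one_le_iff_ne_zero.2 (Nat.mul_ne_zero hE0 hD0)
  have hE'0 : E' ≠ 0 := by omega
  have hE' : ∀ p : ℕ, p.Prime → ¬ p ∣ E' →
      omegaL L p = n + 1 ∧ ∀ j : Fin n, ¬ p ∣ (crossDet L m (m.succAbove j)).natAbs := by
    intro p hp hpE'
    refine ⟨hE p hp fun h => hpE' (h.mul_right _), fun j h => hpE' (Dvd.dvd.mul_left ?_ _)⟩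
    exact h.trans (Finset.dvd_prod_of_mem (fun i : Fin n => (crossDet L m (m.succAbove i)).natAbs)
      (Finset.mem_univ j))
  -- sizes: `D ≤ M^n`, `log E' ≤ 10 k² log x ≤ 20 k² log X`
  have hDle : (D : ℝ) ≤ M ^ n := by
    rw [hDdef]
    push_cast
    calc ∏ j : Fin n, (((crossDet L m (m.succAbove j)).natAbs : ℕ) : ℝ) ≤ ∏ _j : Fin n, M :=
          Finset.prod_le_prod (fun j _ => Nat.cast_nonneg _) fun j _ => by
            rw [Nat.cast_natAbs, crossDet]
            push_cast
            exact hcM (m.succAbove j) m (Fin.succAbove_ne m j)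
      _ = M ^ n := by rw [Finset.prod_const, Finset.card_univ, Fintype.card_fin]
  set N := ⌊R⌋₊ with hN
  have hN2r : (2 : ℝ) ≤ N := by exact_mod_cast hN2
  have hN0 : (0 : ℝ) < N := by linarith
  have hlogN : 0 < Real.log N := Real.log_pos (by linarith)
  have hMx : M ≤ (x : ℝ) ^ 5 := by
    have h2x : 2 * (x : ℝ) ≤ x ^ 2 := by nlinarith
    have hl3 : ℓ ^ 3 ≤ (x : ℝ) ^ 3 := pow_le_pow_left₀ hℓ0 hℓx 3
    calc M = 2 * (x : ℝ) * ℓ ^ 3 := hM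
      _ ≤ (x : ℝ) ^ 2 * (x : ℝ) ^ 3 := mul_le_mul h2x hl3 (pow_nonneg hℓ0 3) (pow_nonneg hx0.le 2)
      _ = (x : ℝ) ^ 5 := by ring
  have hM0 : 0 < M := by linarith
  have hlogM : Real.log M ≤ 5 * ℓ := by
    calc Real.log M ≤ Real.log ((x : ℝ) ^ 5) := Real.log_le_log hM0 hMx
      _ = 5 * ℓ := by rw [Real.log_pow, hℓ]; norm_num
  have hlogM0 : 0 ≤ Real.log M := Real.log_nonneg hM1
  have hkk : (((n + 1 + 1) * (n + 1) + n : ℕ) : ℝ) ≤ 2 * κ ^ 2 := by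
    have : (n + 1 + 1) * (n + 1) + n ≤ 2 * (n + 1) ^ 2 := by nlinarith [Nat.zero_le (n * n)]
    rw [hκ]; exact_mod_cast this
  have hE'le : (E' : ℝ) ≤ M ^ ((n + 1 + 1) * (n + 1) + n) := by
    rw [hE'def, Nat.cast_mul, pow_add]
    exact mul_le_mul hEle hDle (Nat.cast_nonneg _) (pow_nonneg hM0.le _)
  have hlogE : Real.log E' ≤ 10 * κ ^ 2 * ℓ := by
    have hE1r : (0 : ℝ) < E' := by exact_mod_cast hE'1
    calc Real.log E' ≤ Real.log (M ^ ((n + 1 + 1) * (n + 1) + n)) := Real.log_le_log hE1r hE'le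
      _ = ((n + 1 + 1) * (n + 1) + n : ℕ) * Real.log M := by rw [Real.log_pow]
      _ ≤ 2 * κ ^ 2 * Real.log M := mul_le_mul_of_nonneg_right hkk hlogM0
      _ ≤ 2 * κ ^ 2 * (5 * ℓ) :=
          mul_le_mul_of_nonneg_left hlogM (mul_nonneg zero_le_two (pow_nonneg hk0 2))
      _ = 10 * κ ^ 2 * ℓ := by ring
  have hlogE' : Real.log E' ≤ 20 * κ ^ 2 * Real.log X := by
    calc Real.log E' ≤ 10 * κ ^ 2 * ℓ := hlogE
      _ ≤ 10 * κ ^ 2 * (2 * Real.log X) :=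
          mul_le_mul_of_nonneg_left hℓX (mul_nonneg (by norm_num) (pow_nonneg hk0 2))
      _ = 20 * κ ^ 2 * Real.log X := by ring
  clear hE'le hEle hDle hMx hkk
  have hlX0 : 0 < Real.log X := by linarith
  -- `|a_m| ≤ log x ≤ ⌊R⌋` (from `60 k³ log²x ≤ ⌊R⌋ log⌊R⌋ ≤ ⌊R⌋²`)
  have hℓN : ℓ ≤ N := by
    have h1 : (60 : ℝ) * κ ^ 3 * ℓ ^ 2 ≤ N * N :=
      hmain.trans (mul_le_mul_of_nonneg_left (Real.log_le_self hN0.le) hN0.le)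
    have h8 : (8 : ℝ) ≤ κ ^ 3 := by nlinarith
    have h2 : ℓ ^ 2 ≤ (N : ℝ) ^ 2 := by nlinarith
    exact (pow_le_pow_iff_left₀ hℓ0 hN0.le two_ne_zero).1 h2
  have haR : (L m).1.natAbs ≤ N := by
    have h1 : (((L m).1.natAbs : ℕ) : ℝ) ≤ N := by
      rw [Nat.cast_natAbs]; push_cast
      exact ((hcoef m).1.trans hℓN)
    exact_mod_cast h1
  have hWi : ∀ j : Fin n, idxModM L B R m j ≤ wCut (n + 1) B * B * E' := fun j => by
    rw [hE'def]; exact idxModM_le hadm hnd B R m hE0 hE j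
  refine ⟨haR, E', hE'1, hE', hlogE', hWi, ?_,
    fun J => logR_cM_sq_mul_piRec_eq_mainCoeffM hn hadm hnd hB0 m haR hE'0 hE' J⟩
  -- `|excProdM − 1| ≤ exp(k b/N) − 1 ≤ 2 k b/N ≤ 1/log X`, `b = #{p ∣ E' : p > N} ≤ 10k² log x/log N`
  set b := #(E'.primeFactors.filter (fun p => N < p)) with hb
  have hbnd : (b : ℝ) * Real.log N ≤ 10 * κ ^ 2 * ℓ :=
    (card_primeFactors_filter_mul_log_le hE'0 N).trans hlogE
  have hcount : 2 * κ * b * Real.log X ≤ N := by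
    have hreal : (2 * κ * b * Real.log X) * Real.log N ≤ N * Real.log N := by
      calc (2 * κ * b * Real.log X) * Real.log N
            = 2 * κ * Real.log X * ((b : ℝ) * Real.log N) := by ring
        _ ≤ 2 * κ * Real.log X * (10 * κ ^ 2 * ℓ) :=
            mul_le_mul_of_nonneg_left hbnd (mul_nonneg (mul_nonneg zero_le_two hk0) hlX0.le)
        _ ≤ 2 * κ * (3 * ℓ) * (10 * κ ^ 2 * ℓ) := by
            have : 2 * κ * Real.log X ≤ 2 * κ * (3 * ℓ) :=
              mul_le_mul_of_nonneg_left hXℓ (mul_nonneg zero_le_two hk0)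
            exact mul_le_mul_of_nonneg_right this
              (mul_nonneg (mul_nonneg (by norm_num) (pow_nonneg hk0 2)) hℓ0)
        _ = 60 * κ ^ 3 * ℓ ^ 2 := by ring
        _ ≤ N * Real.log N := hmain
    exact le_of_mul_le_mul_right hreal hlogN
  set t : ℝ := κ * b / N with ht
  have ht0 : 0 ≤ t := div_nonneg (mul_nonneg hk0 (Nat.cast_nonneg _)) hN0.le
  have ht1 : 2 * t * Real.log X ≤ 1 := by
    rw [ht, show 2 * (κ * b / N) * Real.log X = (2 * κ * b * Real.log X) / N by ring,
      div_le_one hN0]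
    exact hcount
  have htle : t ≤ 1 := by nlinarith
  have hexp : Real.exp t - 1 ≤ 2 * t := by
    have h := Real.abs_exp_sub_one_le (x := t) (by rw [abs_of_nonneg ht0]; exact htle)
    rw [abs_of_nonneg ht0] at h
    exact (abs_le.1 h).2
  have hN1 : 1 ≤ N := le_trans (by norm_num) hN2
  calc |excProdM L m (wCut (n + 1) B * B) N E' - 1| ≤ Real.exp t - 1 := by
        rw [ht]; exact abs_excProdM_sub_one_le hadm m _ hN1 E'
    _ ≤ 2 * t := hexp
    _ ≤ 1 / Real.log X := by rw [le_div_iff₀ hlX0]; exact ht1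

end Literature.NumberTheory.Sieve.FGKMT2018
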